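import Literature.Analysis.Potential.HarmonicPolynomialGaussianOrthogonality
import Mathlib
import HarnessLib

/-!
# Orthogonality of spherical harmonics of different degrees on `S^{n−1}`, and radially weighted channel projection

Polar coordinates (`homeomorphUnitSphereProd`, `Measure.toSphere`, `Measure.volumeIoiPow`) separate a radially weighted product of two
HOMOGENEOUS polynomials:

* `integral_radial_mul_homogeneous` (separation of variables, no integrability hypotheses — both sides carry the same junk value):
  `∫_{ℝⁿ} w(‖x‖) P(x) Q(x) dx = (∫_{S^{n−1}} P Q dσ) · (∫_{(0,∞)} w(r) r^{k+l} r^{n−1} dr)` for `P`, `Q` homogeneous of degrees `k`, `l`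
  (`σ = volume.toSphere`, the radial measure is `volumeIoiPow (n−1)`);
* ★ `integral_sphere_harmonic_mul_eq_zero` — SPHERICAL HARMONICS OF DIFFERENT DEGREES ARE ORTHOGONAL IN `L²(S^{n−1})`
  [cite: AxlerBourdonRamey2001, Prop. 5.9]: `∫_{S^{n−1}} P Q dσ = 0` for harmonic homogeneous `P`, `Q` of degrees `k ≠ l`
  (from the Gaussian form ✓`integral_harmonic_mul_exp_eq_zero` and the positivity of the Gaussian radial moment);
* ★ `integral_radial_mul_harmonic_eq_zero` — hence `∫_{ℝⁿ} w(‖x‖) P(x) Q(x) dx = 0` for EVERY radial weight `w` — the channel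
  projection of radially weighted harmonic expansions `Σ_j β_j(‖x‖) B_j(x)` (only the channels of the probing degree survive).

Mathlib has the polar-coordinate measure decomposition but no spherical harmonics.
-/

set_option autoImplicit false

noncomputable section

namespace Literature.Analysis.Potential

open MvPolynomial _root_.MeasureTheory _root_.MeasureTheory.Measure Set Metric
open scoped BigOperators

variable {n : ℕ}

/-- `φ(c • x) = c^m φ(x)` for `φ` homogeneous of degree `m`. [folklore] -/
private theorem eval_smul_of_isHomogeneous'' {φ : MvPolynomial (Fin n) ℝ} {m : ℕ} (hφ : φ.IsHomogeneous m)
    (c : ℝ) (x : Fin n → ℝ) : eval (c • x) φ = c ^ m * eval x φ := by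
  classical
  rw [eval_eq, eval_eq, Finset.mul_sum]
  refine Finset.sum_congr rfl fun d hd => ?_
  simp only [Pi.smul_apply, smul_eq_mul, mul_pow, Finset.prod_mul_distrib, Finset.prod_pow_eq_pow_sum]
  rw [← hφ.degree_eq_sum_deg_support hd]
  ring

/-! ## § 1. Separation of variables in polar coordinates -/

/-- **Separation of variables**: for `P`, `Q` homogeneous of degrees `k`, `l` on `ℝⁿ` (`n ≥ 1`) and any radial weight `w`,
`∫ w(‖x‖) P(x) Q(x) dx = (∫_{S^{n−1}} P Q d(volume.toSphere)) · (∫ w(r) r^{k+l} d(volumeIoiPow (n−1)))`.  No integrability hypotheses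
(the change of variables is a measurable equivalence and `integral_prod_mul` is unconditional). [cite: AxlerBourdonRamey2001, Prop. 5.9] -/
theorem integral_radial_mul_homogeneous (hn : 0 < n) (P Q : MvPolynomial (Fin n) ℝ) {k l : ℕ}
    (hP : P.IsHomogeneous k) (hQ : Q.IsHomogeneous l) (w : ℝ → ℝ) :
    ∫ x : EuclideanSpace ℝ (Fin n), w ‖x‖ * (eval (WithLp.ofLp x) P * eval (WithLp.ofLp x) Q)
      = (∫ ω : sphere (0 : EuclideanSpace ℝ (Fin n)) 1,
            eval (WithLp.ofLp (ω : EuclideanSpace ℝ (Fin n))) P * eval (WithLp.ofLp (ω : EuclideanSpace ℝ (Fin n))) Q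
            ∂((volume : Measure (EuclideanSpace ℝ (Fin n))).toSphere))
        * ∫ r : Ioi (0 : ℝ), w r.1 * r.1 ^ (k + l) ∂(volumeIoiPow (n - 1)) := by
  haveI : Nontrivial (EuclideanSpace ℝ (Fin n)) :=
    Module.nontrivial_of_finrank_pos (R := ℝ) (by rw [finrank_euclideanSpace_fin]; exact hn)
  -- the integrand and its polar form
  set F : EuclideanSpace ℝ (Fin n) → ℝ := fun x => w ‖x‖ * (eval (WithLp.ofLp x) P * eval (WithLp.ofLp x) Q) with hF
  set G : sphere (0 : EuclideanSpace ℝ (Fin n)) 1 × Ioi (0 : ℝ) → ℝ := fun z =>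
    (eval (WithLp.ofLp (z.1 : EuclideanSpace ℝ (Fin n))) P * eval (WithLp.ofLp (z.1 : EuclideanSpace ℝ (Fin n))) Q)
      * (w z.2.1 * z.2.1 ^ (k + l)) with hG
  -- `F = G ∘ polar` off the origin
  have hFG : ∀ x : ({0}ᶜ : Set (EuclideanSpace ℝ (Fin n))),
      F x.1 = G (homeomorphUnitSphereProd (EuclideanSpace ℝ (Fin n)) x) := by
    intro x
    have hx : (x.1 : EuclideanSpace ℝ (Fin n)) ≠ 0 := x.2
    have hnorm : 0 < ‖(x.1 : EuclideanSpace ℝ (Fin n))‖ := norm_pos_iff.mpr hx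
    have h1 : ((homeomorphUnitSphereProd (EuclideanSpace ℝ (Fin n)) x).1 : EuclideanSpace ℝ (Fin n))
        = ‖(x.1 : EuclideanSpace ℝ (Fin n))‖⁻¹ • (x.1 : EuclideanSpace ℝ (Fin n)) := by
      simp [homeomorphUnitSphereProd_apply_fst_coe]
    have h2 : ((homeomorphUnitSphereProd (EuclideanSpace ℝ (Fin n)) x).2 : ℝ) = ‖(x.1 : EuclideanSpace ℝ (Fin n))‖ := by
      simp [homeomorphUnitSphereProd_apply_snd_coe]
    rw [hG]
    simp only []
    rw [h1, h2, WithLp.ofLp_smul, eval_smul_of_isHomogeneous'' hP, eval_smul_of_isHomogeneous'' hQ, hF]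
    simp only []
    have hne : ‖(x.1 : EuclideanSpace ℝ (Fin n))‖ ≠ 0 := hnorm.ne'
    have hk' : ‖(x.1 : EuclideanSpace ℝ (Fin n))‖⁻¹ ^ k * ‖(x.1 : EuclideanSpace ℝ (Fin n))‖ ^ k = 1 := by
      rw [← mul_pow, inv_mul_cancel₀ hne, one_pow]
    have hl' : ‖(x.1 : EuclideanSpace ℝ (Fin n))‖⁻¹ ^ l * ‖(x.1 : EuclideanSpace ℝ (Fin n))‖ ^ l = 1 := by
      rw [← mul_pow, inv_mul_cancel₀ hne, one_pow]
    calc w ‖(x.1 : EuclideanSpace ℝ (Fin n))‖ * (eval (WithLp.ofLp (x.1 : EuclideanSpace ℝ (Fin n))) P *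
          eval (WithLp.ofLp (x.1 : EuclideanSpace ℝ (Fin n))) Q)
        = w ‖(x.1 : EuclideanSpace ℝ (Fin n))‖ * (eval (WithLp.ofLp (x.1 : EuclideanSpace ℝ (Fin n))) P *
          eval (WithLp.ofLp (x.1 : EuclideanSpace ℝ (Fin n))) Q)
          * (‖(x.1 : EuclideanSpace ℝ (Fin n))‖⁻¹ ^ k * ‖(x.1 : EuclideanSpace ℝ (Fin n))‖ ^ k)
          * (‖(x.1 : EuclideanSpace ℝ (Fin n))‖⁻¹ ^ l * ‖(x.1 : EuclideanSpace ℝ (Fin n))‖ ^ l) := by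
            rw [hk', hl', mul_one, mul_one]
      _ = _ := by rw [pow_add]; ring
  calc ∫ x, F x
      = ∫ x : ({0}ᶜ : Set (EuclideanSpace ℝ (Fin n))), F x.1 ∂((volume : Measure (EuclideanSpace ℝ (Fin n))).comap (↑)) := by
        rw [integral_subtype_comap (measurableSet_singleton _).compl F, restrict_compl_singleton]
    _ = ∫ x : ({0}ᶜ : Set (EuclideanSpace ℝ (Fin n))), G (homeomorphUnitSphereProd (EuclideanSpace ℝ (Fin n)) x)
          ∂((volume : Measure (EuclideanSpace ℝ (Fin n))).comap (↑)) := by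
        refine integral_congr_ae (Filter.Eventually.of_forall fun x => hFG x)
    _ = ∫ z, G z ∂(((volume : Measure (EuclideanSpace ℝ (Fin n))).toSphere).prod
          (volumeIoiPow (Module.finrank ℝ (EuclideanSpace ℝ (Fin n)) - 1))) :=
        (volume : Measure (EuclideanSpace ℝ (Fin n))).measurePreserving_homeomorphUnitSphereProd.integral_comp
          (Homeomorph.measurableEmbedding _) G
    _ = _ := by
        rw [finrank_euclideanSpace_fin]
        exact integral_prod_mul (μ := ((volume : Measure (EuclideanSpace ℝ (Fin n))).toSphere))
          (ν := volumeIoiPow (n - 1))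
          (fun ω : sphere (0 : EuclideanSpace ℝ (Fin n)) 1 =>
            eval (WithLp.ofLp (ω : EuclideanSpace ℝ (Fin n))) P * eval (WithLp.ofLp (ω : EuclideanSpace ℝ (Fin n))) Q)
          (fun r : Ioi (0 : ℝ) => w r.1 * r.1 ^ (k + l))

/-! ## § 2. The Gaussian radial moment is positive -/

/-- `0 < ∫_{(0,∞)} e^{−a r²} r^m r^{n−1} dr` (as an integral against `volumeIoiPow (n−1)`). [folklore] -/
private theorem radialGaussianMoment_pos {a : ℝ} (ha : 0 < a) (m : ℕ) :
    0 < ∫ r : Ioi (0 : ℝ), Real.exp (-(a * r.1 ^ 2)) * r.1 ^ m ∂(volumeIoiPow (n - 1)) := by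
  -- rewrite as a set integral over `(0, ∞)`
  have hrw : ∫ r : Ioi (0 : ℝ), Real.exp (-(a * r.1 ^ 2)) * r.1 ^ m ∂(volumeIoiPow (n - 1))
      = ∫ r in Ioi (0 : ℝ), r ^ (n - 1) * (Real.exp (-(a * r ^ 2)) * r ^ m) := by
    simp only [Measure.volumeIoiPow, ENNReal.ofReal]
    rw [integral_withDensity_eq_integral_smul,
      integral_subtype_comap measurableSet_Ioi fun r => Real.toNNReal (r ^ (n - 1)) • (Real.exp (-(a * r ^ 2)) * r ^ m),
      setIntegral_congr_fun measurableSet_Ioi fun r hr => ?_]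
    · rw [NNReal.smul_def, Real.coe_toNNReal _ (pow_nonneg hr.out.le _), smul_eq_mul]
    · exact (measurable_subtype_coe.pow_const _).real_toNNReal
  rw [hrw]
  -- the integrand is positive and integrable on `(0, ∞)`
  have hint : IntegrableOn (fun r : ℝ => r ^ (n - 1) * (Real.exp (-(a * r ^ 2)) * r ^ m)) (Ioi 0) := by
    have hs : (-1 : ℝ) < ((n - 1 + m : ℕ) : ℝ) := by
      have : (0 : ℝ) ≤ ((n - 1 + m : ℕ) : ℝ) := Nat.cast_nonneg _
      linarith
    have h := integrableOn_rpow_mul_exp_neg_mul_sq ha hs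
    refine h.congr_fun (fun r _ => ?_) measurableSet_Ioi
    simp only [Real.rpow_natCast, pow_add]
    ring_nf
  have hpos : 0 < (volume : Measure ℝ) (Function.support (fun r : ℝ => r ^ (n - 1) * (Real.exp (-(a * r ^ 2)) * r ^ m)) ∩ Ioi 0) := by
    have hsub : Ioi (0 : ℝ) ⊆ Function.support (fun r : ℝ => r ^ (n - 1) * (Real.exp (-(a * r ^ 2)) * r ^ m)) ∩ Ioi 0 := by
      intro r hr
      refine ⟨?_, hr⟩
      rw [Function.mem_support]
      have hr' : 0 < r := hr
      positivity
    exact lt_of_lt_of_le (by simp) (measure_mono hsub)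
  refine (setIntegral_pos_iff_support_of_nonneg_ae ?_ hint).mpr hpos
  refine (ae_restrict_iff' measurableSet_Ioi).mpr (Filter.Eventually.of_forall fun r hr => ?_)
  have hr' : 0 < r := hr
  positivity

/-! ## § 3. Orthogonality on the sphere and for every radial weight -/

/-- ★ **Spherical harmonics of different degrees are orthogonal in `L²(S^{n−1})`**: for harmonic homogeneous `P`, `Q` on `ℝⁿ`
(`n ≥ 1`) of degrees `k ≠ l`, `∫_{S^{n−1}} P Q dσ = 0` (`σ = volume.toSphere`). [cite: AxlerBourdonRamey2001, Prop. 5.9] -/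
theorem integral_sphere_harmonic_mul_eq_zero (hn : 0 < n) (P Q : MvPolynomial (Fin n) ℝ) {k l : ℕ}
    (hP : P.IsHomogeneous k) (hQ : Q.IsHomogeneous l)
    (hPh : ∑ i, pderiv i (pderiv i P) = 0) (hQh : ∑ i, pderiv i (pderiv i Q) = 0) (hkl : k ≠ l) :
    ∫ ω : sphere (0 : EuclideanSpace ℝ (Fin n)) 1,
        eval (WithLp.ofLp (ω : EuclideanSpace ℝ (Fin n))) P * eval (WithLp.ofLp (ω : EuclideanSpace ℝ (Fin n))) Q
        ∂((volume : Measure (EuclideanSpace ℝ (Fin n))).toSphere) = 0 := by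
  -- the Gaussian-weighted integral vanishes and separates
  have hgauss := integral_harmonic_mul_exp_eq_zero P Q hP hQ hPh hQh hkl one_pos
  have hsep := integral_radial_mul_homogeneous hn P Q hP hQ (fun r => Real.exp (-(1 * r ^ 2)))
  have hL : ∫ x : EuclideanSpace ℝ (Fin n), Real.exp (-(1 * ‖x‖ ^ 2)) * (eval (WithLp.ofLp x) P * eval (WithLp.ofLp x) Q)
      = ∫ x : EuclideanSpace ℝ (Fin n), eval (WithLp.ofLp x) P * eval (WithLp.ofLp x) Q * Real.exp (-(1 * ‖x‖ ^ 2)) := by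
    refine integral_congr_ae (Filter.Eventually.of_forall fun x => ?_)
    ring
  rw [hL, hgauss] at hsep
  -- the radial factor is positive
  have hc := radialGaussianMoment_pos (n := n) one_pos (k + l)
  rcases mul_eq_zero.mp hsep.symm with h | h
  · exact h
  · exact absurd h hc.ne'

/-- ★ **Radially weighted orthogonality / channel projection**: for harmonic homogeneous `P`, `Q` on `ℝⁿ` (`n ≥ 1`) of degrees
`k ≠ l` and EVERY radial weight `w`, `∫_{ℝⁿ} w(‖x‖) P(x) Q(x) dx = 0`. [cite: AxlerBourdonRamey2001, Prop. 5.9] -/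
theorem integral_radial_mul_harmonic_eq_zero (hn : 0 < n) (P Q : MvPolynomial (Fin n) ℝ) {k l : ℕ}
    (hP : P.IsHomogeneous k) (hQ : Q.IsHomogeneous l)
    (hPh : ∑ i, pderiv i (pderiv i P) = 0) (hQh : ∑ i, pderiv i (pderiv i Q) = 0) (hkl : k ≠ l) (w : ℝ → ℝ) :
    ∫ x : EuclideanSpace ℝ (Fin n), w ‖x‖ * (eval (WithLp.ofLp x) P * eval (WithLp.ofLp x) Q) = 0 := by
  rw [integral_radial_mul_homogeneous hn P Q hP hQ w, integral_sphere_harmonic_mul_eq_zero hn P Q hP hQ hPh hQh hkl,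
    zero_mul]

/-! ## § 4. Channel projection of a finite radially weighted harmonic expansion (appended) -/

/-- ★ **Channel projection**: if `K(x) = Σ_j β_j(‖x‖) B_j(x)` off the origin with `B_j` harmonic homogeneous of degrees `e_j`
(finitely many terms, each `β_j(‖x‖) w(‖x‖) B_j(x) B(x)` integrable), then pairing with a harmonic homogeneous `B` of degree `L` and a
radial weight `w` sees only the channels of degree `L`:
`∫ K(x) B(x) w(‖x‖) dx = Σ_{e_j = L} ∫ β_j(‖x‖) w(‖x‖) B_j(x) B(x) dx`. [cite: AxlerBourdonRamey2001, Prop. 5.9] -/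
theorem integral_harmonicExpansion_mul_harmonic (hn : 0 < n) {ι : Type*} [Fintype ι] [DecidableEq ι]
    (K : EuclideanSpace ℝ (Fin n) → ℝ) (B : ι → MvPolynomial (Fin n) ℝ) (e : ι → ℕ) (β : ι → ℝ → ℝ)
    (hB : ∀ j, (B j).IsHomogeneous (e j)) (hBh : ∀ j, ∑ i, pderiv i (pderiv i (B j)) = 0)
    (hK : ∀ x : EuclideanSpace ℝ (Fin n), x ≠ 0 → K x = ∑ j, β j ‖x‖ * eval (WithLp.ofLp x) (B j))
    (Bp : MvPolynomial (Fin n) ℝ) {L : ℕ} (hBp : Bp.IsHomogeneous L) (hBph : ∑ i, pderiv i (pderiv i Bp) = 0)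
    (w : ℝ → ℝ)
    (hint : ∀ j, Integrable (fun x : EuclideanSpace ℝ (Fin n) =>
      (β j ‖x‖ * w ‖x‖) * (eval (WithLp.ofLp x) (B j) * eval (WithLp.ofLp x) Bp))) :
    ∫ x : EuclideanSpace ℝ (Fin n), K x * eval (WithLp.ofLp x) Bp * w ‖x‖
      = ∑ j ∈ Finset.univ.filter (fun j => e j = L), ∫ x : EuclideanSpace ℝ (Fin n),
          (β j ‖x‖ * w ‖x‖) * (eval (WithLp.ofLp x) (B j) * eval (WithLp.ofLp x) Bp) := by
  haveI : Nontrivial (EuclideanSpace ℝ (Fin n)) :=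
    Module.nontrivial_of_finrank_pos (R := ℝ) (by rw [finrank_euclideanSpace_fin]; exact hn)
  -- expand `K` almost everywhere (the origin is null)
  have hae : (fun x : EuclideanSpace ℝ (Fin n) => K x * eval (WithLp.ofLp x) Bp * w ‖x‖)
      =ᵐ[volume] fun x => ∑ j, (β j ‖x‖ * w ‖x‖) * (eval (WithLp.ofLp x) (B j) * eval (WithLp.ofLp x) Bp) := by
    have h0 : ∀ᵐ x : EuclideanSpace ℝ (Fin n) ∂volume, x ≠ 0 := by
      have : (volume : Measure (EuclideanSpace ℝ (Fin n))) {0} = 0 := measure_singleton 0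
      filter_upwards [measure_eq_zero_iff_ae_notMem.mp this] with x hx
      simpa using hx
    filter_upwards [h0] with x hx
    rw [hK x hx, Finset.sum_mul, Finset.sum_mul]
    exact Finset.sum_congr rfl fun j _ => by ring
  rw [integral_congr_ae hae, integral_finsetSum _ (fun j _ => hint j)]
  -- the channels of degree `≠ L` drop out
  rw [← Finset.sum_filter_add_sum_filter_not Finset.univ (fun j => e j = L)]
  have hzero : ∑ j ∈ Finset.univ.filter (fun j => ¬ e j = L), ∫ x : EuclideanSpace ℝ (Fin n),
      (β j ‖x‖ * w ‖x‖) * (eval (WithLp.ofLp x) (B j) * eval (WithLp.ofLp x) Bp) = 0 := by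
    refine Finset.sum_eq_zero fun j hj => ?_
    rw [Finset.mem_filter] at hj
    exact integral_radial_mul_harmonic_eq_zero hn (B j) Bp (hB j) hBp (hBh j) hBph hj.2 (fun r => β j r * w r)
  rw [hzero, add_zero]

end Literature.Analysis.Potential

end
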